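import Mathlib
import HarnessLib
import Literature.MathematicalPhysics.QuantumFieldTheory.OSReconstructionNoE1
import Literature.MathematicalPhysics.QuantumFieldTheory.SchwartzTensorNorms
import Literature.MathematicalPhysics.QuantumLattice.SchwartzNuclearExpansionBounds
import Literature.MathematicalPhysics.QuantumLattice.SchwartzReIm

/-!
# `CurvatureKernelBound` — stub A1 support: frame change and Schwartz-norm invariances

Support file for crux `stmt-QuantumFields-11687` (`PencilRigidity.CurvatureKernelBound`), line
`sixteen-charts-analytic-kernel`, stub `ChartDerivativeBounds` (A1).  Moving a one-species Schwinger
family and its test functions from the frame of a linear isometry `R` (mirror normal `n = R e₀`) to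
the time frame `e₀`:

* Schwartz norms do not increase under `conj`, under composition with a linear isometry, under
  `Θ`; the two-point tensor bound `|f ⊗ g|_M ≤ 4^{M+1} |f|_M |g|_M` (from the tree's
  `schwartzNorm_tensorFin_le`);
* `linActMulti R (fR ⊗ gR) = f ⊗ g` for `fR = f ∘ R`, iterated line derivatives and supports under
  `f ↦ f ∘ R`, `⟪y, e₀⟫ = y₀`;
* `⁰𝒮` is stable under `linActMulti R`, `linActMulti R` intertwines translations, and hence the
  pulled-back family `n ↦ 𝔖ₙ ∘ linActMulti R` is translation invariant on `⁰𝒮` when `𝔖` is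
  (registered sub-goal `PulledBackTranslationInvariant`).
[folklore]
-/

noncomputable section

open scoped SchwartzMap LineDeriv ComplexConjugate
open Filter Set
open Literature.MathematicalPhysics.AQFT Literature.MathematicalPhysics.QuantumLattice
open Literature.MathematicalPhysics.QuantumFieldTheory

namespace Summit.QuantumFields.YangMills.Theorems.CurvatureKernel

/-! ## Schwartz norms under conjugation, isometries and tensor products -/

section Seminorms

variable {E : Type*} [NormedAddCommGroup E] [NormedSpace ℝ E]

/-- `|conj ∘ φ|_M ≤ |φ|_M`. [folklore] -/
theorem schwartzNorm_starTest_le (M : ℕ) (φ : 𝓢(E, ℂ)) : schwartzNorm M (starTest φ) ≤ schwartzNorm M φ := by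
  refine Seminorm.finset_sup_apply_le (schwartzNorm_nonneg M φ) fun i hi => ?_
  obtain ⟨ha, hb⟩ := Prod.mk_le_mk.1 (Finset.mem_Iic.1 hi)
  rw [SchwartzMap.schwartzSeminormFamily_apply]
  refine (seminorm_postcomp_le_of_norm_le_one (Complex.conjCLE : ℂ →L[ℝ] ℂ) ?_ φ (starTest φ)
    (fun x => rfl) i.1 i.2).trans (seminorm_le_schwartzNorm ha hb φ)
  rw [Complex.conjCLE_norm]

/-- **Schwartz norms are invariant under linear isometries**: `|f ∘ R|_M ≤ |f|_M`. [folklore] -/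
theorem schwartzNorm_compCLMOfContinuousLinearEquiv_isometry_le (R : E ≃ₗᵢ[ℝ] E) (M : ℕ) (f : 𝓢(E, ℂ)) :
    schwartzNorm M (SchwartzMap.compCLMOfContinuousLinearEquiv ℂ R.toContinuousLinearEquiv f) ≤
      schwartzNorm M f := by
  have h := NuclearExpansion.schwartzNorm_compCLMOfContinuousLinearEquiv_le M R.toContinuousLinearEquiv f
  have h1 : ‖(R.toContinuousLinearEquiv : E →L[ℝ] E)‖ ≤ 1 :=
    ContinuousLinearMap.opNorm_le_bound _ zero_le_one fun x => by simp
  have h2 : ‖(R.toContinuousLinearEquiv.symm : E →L[ℝ] E)‖ ≤ 1 :=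
    ContinuousLinearMap.opNorm_le_bound _ zero_le_one fun x => by
      rw [one_mul]
      exact le_of_eq (R.symm.norm_map x)
  have hmax : max 1 (max ‖(R.toContinuousLinearEquiv.symm : E →L[ℝ] E)‖
      ‖(R.toContinuousLinearEquiv : E →L[ℝ] E)‖) = 1 := max_eq_left (max_le h2 h1)
  rw [hmax, one_pow, one_mul] at h
  exact h

/-- `|φ ∘ θ|_M ≤ |φ|_M`. [folklore] -/
theorem schwartzNorm_thetaTest_le {d : ℕ} [NeZero d] (M : ℕ) (φ : 𝓢(EuclideanSpace ℝ (Fin d), ℂ)) :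
    schwartzNorm M (thetaTest d φ) ≤ schwartzNorm M φ :=
  schwartzNorm_compCLMOfContinuousLinearEquiv_isometry_le (timeReflection d).symm M φ

/-- `|conj ∘ φ ∘ θ|_M ≤ |φ|_M`. [folklore] -/
theorem schwartzNorm_starTest_thetaTest_le {d : ℕ} [NeZero d] (M : ℕ) (φ : 𝓢(EuclideanSpace ℝ (Fin d), ℂ)) :
    schwartzNorm M (starTest (thetaTest d φ)) ≤ schwartzNorm M φ :=
  (schwartzNorm_starTest_le M _).trans (schwartzNorm_thetaTest_le M φ)

/-- **Two-point tensor bound**: `|f ⊗ g|_M ≤ (2^{M+1})² |f|_M |g|_M`. [folklore] -/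
theorem schwartzNorm_tensorFin_two_le (M : ℕ) (f g : 𝓢(E, ℂ)) :
    schwartzNorm M (SchwartzMap.tensorFin 2 ![f, g]) ≤ (2 ^ (M + 1)) ^ 2 * schwartzNorm M f * schwartzNorm M g := by
  have h := schwartzNorm_tensorFin_le ![f, g] M
  rw [Fin.prod_univ_two] at h
  simpa [mul_assoc] using h

/-- Translates by vectors of norm `≤ 1` cost at most `4^M`: `|f(· − a)|_M ≤ 4^M |f|_M`. [folklore] -/
theorem schwartzNorm_compSubConstCLM_le_of_norm_le_one (M : ℕ) {a : E} (ha : ‖a‖ ≤ 1) (f : 𝓢(E, ℂ)) :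
    schwartzNorm M (SchwartzMap.compSubConstCLM ℂ a f) ≤ 4 ^ M * schwartzNorm M f := by
  refine (NuclearExpansion.schwartzNorm_compSubConstCLM_le M a f).trans ?_
  have h4 : (2 * (1 + ‖a‖)) ^ M ≤ (4 : ℝ) ^ M := pow_le_pow_left₀ (by positivity) (by linarith) M
  exact mul_le_mul_of_nonneg_right h4 (schwartzNorm_nonneg M f)

end Seminorms

/-! ## Frame change -/

section Frame

variable {E : Type*} [NormedAddCommGroup E] [NormedSpace ℝ E]

/-- **`linActMulti R (fR ⊗ gR) = f ⊗ g`** for `fR = f ∘ R`, `gR = g ∘ R`. [folklore] -/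
theorem linActMulti_tensorFin_two_comp (R : E ≃ₗᵢ[ℝ] E) (f g : 𝓢(E, ℂ)) :
    linActMulti R (SchwartzMap.tensorFin 2
        ![SchwartzMap.compCLMOfContinuousLinearEquiv ℂ R.toContinuousLinearEquiv f,
          SchwartzMap.compCLMOfContinuousLinearEquiv ℂ R.toContinuousLinearEquiv g]) =
      SchwartzMap.tensorFin 2 ![f, g] := by
  ext x
  simp [Fin.prod_univ_two]

/-- Iterated line derivatives under a linear change of variables:
`(∂_v)^[N] (f ∘ L) = ((∂_{Lv})^[N] f) ∘ L`. [folklore] -/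
theorem iterate_lineDerivOp_compCLMOfContinuousLinearEquiv {D : Type*} [NormedAddCommGroup D]
    [NormedSpace ℝ D] (L : D ≃L[ℝ] E) (v : D) (N : ℕ) (f : 𝓢(E, ℂ)) :
    ((∂_{v} : 𝓢(D, ℂ) → 𝓢(D, ℂ))^[N] (SchwartzMap.compCLMOfContinuousLinearEquiv ℂ L f)) =
      SchwartzMap.compCLMOfContinuousLinearEquiv ℂ L (((∂_{L v} : 𝓢(E, ℂ) → 𝓢(E, ℂ))^[N] f)) := by
  induction N with
  | zero => rfl
  | succ N ih =>
    rw [Function.iterate_succ_apply', ih, SchwartzMap.lineDerivOp_compCLMOfContinuousLinearEquiv,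
      Function.iterate_succ_apply']

/-- Supports under a linear change of variables: `y ∈ supp (f ∘ L) → L y ∈ supp f`. [folklore] -/
theorem apply_mem_tsupport_of_mem_tsupport_compCLMOfContinuousLinearEquiv {D : Type*}
    [NormedAddCommGroup D] [NormedSpace ℝ D] (L : D ≃L[ℝ] E) (f : 𝓢(E, ℂ)) {y : D}
    (hy : y ∈ tsupport ((SchwartzMap.compCLMOfContinuousLinearEquiv ℂ L f : 𝓢(D, ℂ)) : D → ℂ)) :
    L y ∈ tsupport (f : E → ℂ) :=
  tsupport_comp_subset_preimage (f : E → ℂ) L.continuous hy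

/-- `linActMulti R` intertwines the translations: `(F_{(a,1)})^R = (F^R)_{(Ra,1)}`. [folklore] -/
theorem linActMulti_translateMulti {n : ℕ} (R : E ≃ₗᵢ[ℝ] E) (a : E) (F : 𝓢((Fin n → E), ℂ)) :
    linActMulti R (translateMulti a F) = translateMulti (R a) (linActMulti R F) := by
  ext x
  simp [map_sub]

/-- **`⁰𝒮` is stable under `linActMulti R`.** [folklore] -/
theorem isOffDiagonal_linActMulti {n : ℕ} (R : E ≃ₗᵢ[ℝ] E) {F : 𝓢((Fin n → E), ℂ)}
    (hF : IsOffDiagonal F) : IsOffDiagonal (linActMulti R F) := by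
  intro x hx k
  set Λ : (Fin n → E) →L[ℝ] (Fin n → E) :=
    ((ContinuousLinearEquiv.piCongrRight fun _ : Fin n => R.symm.toContinuousLinearEquiv :
      (Fin n → E) ≃L[ℝ] (Fin n → E)) : (Fin n → E) →L[ℝ] (Fin n → E)) with hΛ
  have hfun : ((linActMulti R F : 𝓢((Fin n → E), ℂ)) : (Fin n → E) → ℂ) = (F : (Fin n → E) → ℂ) ∘ Λ := by
    funext y
    rfl
  have hx' : Λ x ∈ coincidenceLocus n E := by
    obtain ⟨i, j, hij, hxij⟩ := hx
    refine ⟨i, j, hij, ?_⟩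
    change R.symm.toContinuousLinearEquiv (x i) = R.symm.toContinuousLinearEquiv (x j)
    rw [hxij]
  rw [hfun, Λ.iteratedFDeriv_comp_right (F.smooth _) x (i := k) (mod_cast le_top), hF _ hx' k]
  ext m
  simp

/-- **The pulled-back family is translation invariant on `⁰𝒮`**: if the one-species family `𝔖`
is translation invariant on `⁰𝒮`, so is `n ↦ 𝔖ₙ ∘ linActMulti R` (as a `Unit`-labelled family). [folklore] -/
theorem isTranslationInvariant_toLabelled_comp_linActMulti (S₁ : SchwingerFamily E) (R : E ≃ₗᵢ[ℝ] E)
    (hT : ∀ (n : ℕ) (a : E) (F : 𝓢((Fin n → E), ℂ)), IsOffDiagonal F → S₁ n (translateMulti a F) = S₁ n F) :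
    (SchwingerFamily.toLabelled (fun n => (S₁ n).comp (linActMulti R))).IsTranslationInvariant := by
  intro n _ a F hF
  simp only [SchwingerFamily.toLabelled_apply, ContinuousLinearMap.comp_apply]
  rw [linActMulti_translateMulti]
  exact hT n (R a) _ (isOffDiagonal_linActMulti R hF)

/-- `⟪y, e₀⟫ = y₀` for `e₀ = EuclideanSpace.single 0 1`. [folklore] -/
theorem inner_single_zero_one {d : ℕ} [NeZero d] (y : EuclideanSpace ℝ (Fin d)) :
    inner ℝ y (EuclideanSpace.single (0 : Fin d) (1 : ℝ)) = y 0 := by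
  rw [EuclideanSpace.inner_single_right]
  simp

/-- **Support transfer to the time frame**: if `supp f ⊆ {x | P ⟪x, R e₀⟫}` then
`supp (f ∘ R) ⊆ {y | P y₀}`. [folklore] -/
theorem tsupport_compCLMOfContinuousLinearEquiv_subset_of_inner {d : ℕ} [NeZero d]
    (R : EuclideanSpace ℝ (Fin d) ≃ₗᵢ[ℝ] EuclideanSpace ℝ (Fin d)) (P : ℝ → Prop)
    {f : 𝓢(EuclideanSpace ℝ (Fin d), ℂ)}
    (hf : tsupport (f : EuclideanSpace ℝ (Fin d) → ℂ) ⊆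
      {x | P (inner ℝ x (R (EuclideanSpace.single (0 : Fin d) (1 : ℝ))))}) :
    tsupport ((SchwartzMap.compCLMOfContinuousLinearEquiv ℂ R.toContinuousLinearEquiv f :
        𝓢(EuclideanSpace ℝ (Fin d), ℂ)) : EuclideanSpace ℝ (Fin d) → ℂ) ⊆ {y | P (y 0)} := by
  intro y hy
  have h := hf (apply_mem_tsupport_of_mem_tsupport_compCLMOfContinuousLinearEquiv
    R.toContinuousLinearEquiv f hy)
  simp only [mem_setOf_eq, LinearIsometryEquiv.coe_toContinuousLinearEquiv,
    LinearIsometryEquiv.inner_map_map, inner_single_zero_one] at h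
  exact h

end Frame

/-- **Sub-goal `PulledBackTranslationInvariant`** (helper for stub `ChartDerivativeBounds`): the
family pulled back by a linear isometry `R`, `n ↦ 𝔖ₙ ∘ linActMulti R`, is translation invariant on
`⁰𝒮` when `𝔖` is — so that `OSReconstructionNoE1` applies in the frame of `R`. [folklore] -/
theorem PulledBackTranslationInvariant : open Literature.MathematicalPhysics.QuantumLattice Literature.MathematicalPhysics.AQFT Literature.MathematicalPhysics.QuantumFieldTheory in ∀ {E : Type*} [NormedAddCommGroup E] [NormedSpace ℝ E] (S₁ : SchwingerFamily E) (R : E ≃ₗᵢ[ℝ] E), (∀ (n : ℕ) (a : E) (F : SchwartzMap (Fin n → E) ℂ), IsOffDiagonal F → S₁ n (translateMulti a F) = S₁ n F) → (SchwingerFamily.toLabelled (fun n => (S₁ n).comp (linActMulti R))).IsTranslationInvariant := by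
  intro E _ _ S₁ R hT
  exact isTranslationInvariant_toLabelled_comp_linActMulti S₁ R hT

end Summit.QuantumFields.YangMills.Theorems.CurvatureKernel
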